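import Mathlib.Geometry.Manifold.LocalDiffeomorph
import Literature.Topology.FourManifolds.MappingTorus
import Literature.Topology.FourManifolds.MappingTorusGlue
import Literature.Topology.FourManifolds.CircleSurgery
import Literature.Topology.FourManifolds.DehnSurgery
import Literature.Topology.FourManifolds.DehnSurgeryUniquenessProofs
import Literature.Topology.FourManifolds.FibredKnot
import Literature.Topology.FourManifolds.Knots
import Literature.Topology.FourManifolds.TorusCoordinates
import Literature.Topology.FourManifolds.SectionCircleNbhd
import Literature.Topology.FourManifolds.SmoothEmbeddingCriteria
import Literature.Topology.FourManifolds.MTorusCoordinates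
import Literature.Topology.FourManifolds.FramedTubularNbhd
import HarnessLib

/-!
# `0`-surgery on a fibred knot is the mapping torus of the capped monodromy

Stub `stub_zeroSurgery_of_fibresWithVia` of line `monodromy-kernel-engine` (crux
stmt-SmoothPoincare4-0366), over the tree's `Knot.FibresWithVia` (`FibredKnot.lean`, definition
item `defn-Knot.FibresWithVia`, namespace opened). Proof (Abe–Tagami, arXiv:1502.01102, §5.5): glue
`Y` along `surgeryRel ν` for THE fibration's `ν` (`IsOpenGluing.surgeryRel_of_hasFraming`); PASTING
LEMMA `isSmoothEmbedding_capMap` (the capped cylinder `capMap : F × S → Y` is the meridian-disc map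
on the disc chart, so an injective local diffeomorphism = open smooth embedding); apply over
`(0, 1)`, `(1/2, 3/2)`; the two capped cylinders cover `Y` and meet along `mappingTorusRel φ`.
-/

noncomputable section
set_option linter.dupNamespace false
open scoped Manifold ContDiff Topology
open Set Function Literature.Topology.FourManifolds Literature.Topology.FourManifolds.Knot

namespace Summit.SmoothPoincare4.SmoothPoincare4.Theorems.ZseCruxRasmussen.MonodromyKernelEngine

/-- Local notation: `𝔼 n = ℝⁿ` (model vector space). -/
local notation "𝔼 " n:arg => EuclideanSpace ℝ (Fin n)
/-- Local notation: `𝕊 n`, the unit sphere in `ℝⁿ⁺¹`. -/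
local notation "𝕊 " n:arg => (Metric.sphere (0 : EuclideanSpace ℝ (Fin (n + 1))) 1)

section LocalDiffeo

variable {E₁ H₁ E₂ H₂ E₃ H₃ : Type*} [NormedAddCommGroup E₁] [NormedSpace ℝ E₁]
  [TopologicalSpace H₁] [NormedAddCommGroup E₂] [NormedSpace ℝ E₂] [TopologicalSpace H₂]
  [NormedAddCommGroup E₃] [NormedSpace ℝ E₃] [TopologicalSpace H₃] {I₁ : ModelWithCorners ℝ E₁ H₁}
  {I₂ : ModelWithCorners ℝ E₂ H₂} {I₃ : ModelWithCorners ℝ E₃ H₃} {X : Type*} [TopologicalSpace X]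
  [ChartedSpace H₁ X] {X' : Type*} [TopologicalSpace X'] [ChartedSpace H₂ X'] {Z : Type*}
  [TopologicalSpace Z] [ChartedSpace H₃ Z]

/-- **Transfer of local diffeomorphisms**: if `ι : X → X'`, `g : X → Z` are local diffeomorphisms
at `x` and `f ∘ ι = g` near `x`, then `f = g ∘ ι⁻¹` is one at `ι x` (Lee 2013, 4.8). [folklore] -/
theorem isLocalDiffeomorphAt_of_comp_eventuallyEq {ι : X → X'} {g : X → Z} {f : X' → Z} {x : X}
    (hι : IsLocalDiffeomorphAt I₁ I₂ ∞ ι x) (hg : IsLocalDiffeomorphAt I₁ I₃ ∞ g x)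
    (h : ∀ᶠ x' in 𝓝 x, f (ι x') = g x') : IsLocalDiffeomorphAt I₂ I₃ ∞ f (ι x) := by
  have hx : hι.localInverse (ι x) = x := hι.localInverse_left_inv hι.localInverse_mem_target
  have hg' : IsLocalDiffeomorphAt I₁ I₃ ∞ g (hι.localInverse (ι x)) := by rwa [hx]
  refine isLocalDiffeomorphAt_congr_nhds'
    (hι.localInverse_isLocalDiffeomorphAt.comp (K := I₃) (P := Z) hg') ?_
  have htend : Filter.Tendsto hι.localInverse (𝓝 (ι x)) (𝓝 x) := by
    have := hι.localInverse_contMDiffAt.continuousAt.tendsto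
    rwa [hx] at this
  filter_upwards [htend.eventually h, hι.localInverse_eventuallyEq_right] with a h2 h3
  exact (congrArg f h3).symm.trans h2

/-- The inclusion of an open submanifold of a boundaryless manifold is a local diffeomorphism at
every point. [folklore] -/
theorem isLocalDiffeomorphAt_subtypeVal [I₁.Boundaryless] [IsManifold I₁ ∞ X]
    (U : TopologicalSpace.Opens X) (x : ↥U) :
    IsLocalDiffeomorphAt I₁ I₁ ∞ (Subtype.val : ↥U → X) x :=
  isLocalDiffeomorphAt_of_isSmoothEmbedding (Manifold.IsSmoothEmbedding.of_opens U)
    (by rw [Subtype.range_coe]; exact U.isOpen) x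

end LocalDiffeo

variable {K : Knot} (ν : Knot.TubularNbhd K) {F : Type*} [TopologicalSpace F] [T1Space F] {p : F}
  {Y : Type*} {S : TopologicalSpace.Opens ℝ}

/-- The disc centre `(0, e^{2πis})` lies in the open solid torus. [folklore] -/
theorem zero_circlePt_mem_solidTorus (s : ℝ) : ((0 : 𝔼 2), circlePt s) ∈ solidTorus := by
  rw [mem_solidTorus_iff, norm_zero]; exact one_pos

open Classical in
/-- **The capped cylinder map** `F × S → Y` of a page embedding `jS : (F ∖ {p}) × S → S³ ∖ K` and
the gluing maps `jc : S³ ∖ K → Y`, `jt : D̊² × 𝕊¹ → Y` of a `0`-surgery: `jc ∘ jS` off the puncture,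
`(p, s) ↦ jt (0, e^{2πis})`, the centre of the disc capping page `s`. [cite: AbeTagami2016, §5.5] -/
def capMap (jS : ↥(punctureAt p) × ↥S → ↥K.complement) (jc : ↥K.complement → Y)
    (jt : ↥solidTorus → Y) (a : F × ↥S) : Y :=
  if h : a.1 = p then jt ⟨((0 : 𝔼 2), circlePt (a.2 : ℝ)), zero_circlePt_mem_solidTorus _⟩
  else jc (jS (⟨a.1, h⟩, a.2))

open Classical in
/-- The meridian-disc map `jt` extended to `ℝ² × 𝕊¹` (junk off the open solid torus). [folklore] -/
def solidTorusExt (jt : ↥solidTorus → Y) (q : (𝔼 2) × (𝕊 1)) : Y :=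
  if h : q ∈ solidTorus then jt ⟨q, h⟩ else jt ⟨((0 : 𝔼 2), q.2), zero_circlePt_mem_solidTorus 0⟩

variable (jS : ↥(punctureAt p) × ↥S → ↥K.complement)
  (jA : ↥(punctureAt p) × ↥mappingTorusPieceOne → ↥K.complement)
  (jB : ↥(punctureAt p) × ↥mappingTorusPieceTwo → ↥K.complement)
  (jc : ↥K.complement → Y) (jt : ↥solidTorus → Y) (d : (𝔼 2) → F)

/-- The capped cylinder map at the puncture. [folklore] -/
theorem capMap_apply_puncture (s : ↥S) :
    capMap jS jc jt (p, s) = jt ⟨((0 : 𝔼 2), circlePt (s : ℝ)), zero_circlePt_mem_solidTorus _⟩ :=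
  dif_pos rfl

/-- The capped cylinder map off the puncture. [folklore] -/
theorem capMap_apply_of_ne {y : F} (hy : y ≠ p) (s : ↥S) :
    capMap jS jc jt (y, s) = jc (jS (⟨y, hy⟩, s)) :=
  dif_neg hy

/-- **A page point is never glued to a disc centre** `(0, v)` (the surgery relation only involves
the punctured discs; Rolfsen (1976), §9.F). [cite: Rolfsen1976, §9.F] -/
theorem apply_ne_apply_centre (hglue : ∀ a b, jc a = jt b ↔ surgeryRel ν a b)
    (a : ↥K.complement) (s : ℝ) :
    jc a ≠ jt ⟨((0 : 𝔼 2), circlePt s), zero_circlePt_mem_solidTorus s⟩ := fun h => by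
  have h1 : ‖(0 : 𝔼 2)‖ ∈ Ioo (0 : ℝ) 1 := ((hglue _ _).1 h).norm_fst_mem_Ioo
  rw [norm_zero] at h1
  exact lt_irrefl _ h1.1

/-- **Consistency on the punctured disc**: `capMap (d w, s) = jt (w, e^{2πis})` for `‖w‖ < 1` —
for `w = r • u ≠ 0` the standard-open-book clause puts the page point `d (r • u)` of angle `s` at
`ν (u, r • e^{2πis})`, which `surgeryRel ν` glues to `(r • u, e^{2πis})` (Rolfsen (1976), §9.F,
§10.K; Abe–Tagami, arXiv:1502.01102, §5.5). [cite: AbeTagami2016, §5.5] -/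
theorem capMap_apply_disc (hglue : ∀ a b, jc a = jt b ↔ surgeryRel ν a b) (hdinj : Injective d)
    (hd0 : d 0 = p)
    (hbook : ∀ (y : ↥(punctureAt p)) (u : 𝕊 1) (r : ℝ), r ∈ Ioo (0 : ℝ) 1 →
      (y : F) = d (r • ((u : 𝕊 1) : 𝔼 2)) → ∀ s : ↥S,
        ((jS (y, s) : ↥K.complement) : 𝕊 3) = ν (u, r • ((circlePt (s : ℝ) : 𝕊 1) : 𝔼 2)))
    {w : 𝔼 2} (hw : ‖w‖ < 1) (s : ↥S) :
    capMap jS jc jt (d w, s) = jt ⟨(w, circlePt (s : ℝ)), (mem_solidTorus_iff _).2 hw⟩ := by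
  by_cases hw0 : w = 0
  · subst hw0; rw [hd0, capMap_apply_puncture]
  · have hne : d w ≠ p := fun h => hw0 (hdinj (h.trans hd0.symm))
    rw [capMap_apply_of_ne jS jc jt hne, hglue]
    have hnorm : 0 < ‖w‖ := norm_pos_iff.2 hw0
    have hu : ‖w‖⁻¹ • w ∈ Metric.sphere (0 : 𝔼 2) 1 := by
      rw [mem_sphere_zero_iff_norm, norm_smul, norm_inv, norm_norm, inv_mul_cancel₀ hnorm.ne']
    have hwu : w = ‖w‖ • ((⟨_, hu⟩ : 𝕊 1) : 𝔼 2) := (smul_inv_smul₀ hnorm.ne' w).symm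
    exact ⟨⟨_, hu⟩, ‖w‖, ⟨hnorm, hw⟩, hwu, hbook ⟨d w, hne⟩ _ ‖w‖ ⟨hnorm, hw⟩ (congrArg d hwu) s⟩

/-- **The pasting lemma for one cylinder.** Over an interval piece `S` with an angle chart
`e : 𝕊¹ ⇀ S` inverting `s ↦ e^{2πis}` (smooth both ways, onto `S`), the capped cylinder map
`F × S → Y` is an open smooth embedding: through `(F ∖ {p}) × S ↪ F × S` it is `jc ∘ jS`, through
`d × id : D̊² × S ↪ F × S` it is `(w, s) ↦ jt (w, e^{2πis})` (`capMap_apply_disc`) — local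
diffeomorphisms of `3`-manifolds — and it is injective (`apply_ne_apply_centre`): "cap the pages
with the meridian discs" (Abe–Tagami, arXiv:1502.01102, §5.5). [cite: AbeTagami2016, §5.5] -/
theorem isSmoothEmbedding_capMap [ChartedSpace (𝔼 2) F] [IsManifold (𝓡 2) ∞ F]
    [TopologicalSpace Y] [ChartedSpace (𝔼 3) Y] [IsManifold (𝓡 3) ∞ Y]
    (hS : Manifold.IsSmoothEmbedding ((𝓡 2).prod 𝓘(ℝ, ℝ)) (𝓡 3) ∞ jS) (hSo : IsOpen (range jS))
    (hc : Manifold.IsSmoothEmbedding (𝓡 3) (𝓡 3) ∞ jc) (hco : IsOpen (range jc))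
    (ht : Manifold.IsSmoothEmbedding (𝓘(ℝ, 𝔼 2).prod (𝓡 1)) (𝓡 3) ∞ jt) (hto : IsOpen (range jt))
    (hd : Manifold.IsSmoothEmbedding (𝓡 2) (𝓡 2) ∞ d) (hdo : IsOpen (range d))
    (hglue : ∀ a b, jc a = jt b ↔ surgeryRel ν a b) (hd0 : d 0 = p)
    (hbook : ∀ (y : ↥(punctureAt p)) (u : 𝕊 1) (r : ℝ), r ∈ Ioo (0 : ℝ) 1 →
      (y : F) = d (r • ((u : 𝕊 1) : 𝔼 2)) → ∀ s : ↥S,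
        ((jS (y, s) : ↥K.complement) : 𝕊 3) = ν (u, r • ((circlePt (s : ℝ) : 𝕊 1) : 𝔼 2)))
    (e : OpenPartialHomeomorph (𝕊 1) ↥S) (het : e.target = univ)
    (he : ContMDiffOn (𝓡 1) 𝓘(ℝ, ℝ) ∞ e e.source) (he' : ContMDiff 𝓘(ℝ, ℝ) (𝓡 1) ∞ e.symm)
    (hes : ∀ s : ↥S, e.symm s = circlePt (s : ℝ)) :
    Manifold.IsSmoothEmbedding ((𝓡 2).prod 𝓘(ℝ, ℝ)) (𝓡 3) ∞ (capMap jS jc jt) ∧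
      IsOpen (range (capMap jS jc jt)) := by
  -- `s ↦ e^{2πis}` is an injective local diffeomorphism on `S`
  let Φ : PartialDiffeomorph 𝓘(ℝ, ℝ) (𝓡 1) ↥S (𝕊 1) ∞ :=
    { toPartialEquiv := e.symm.toPartialEquiv
      open_source := e.open_target
      open_target := e.open_source
      contMDiffOn_toFun := he'.contMDiffOn
      contMDiffOn_invFun := he }
  have hΦs : ∀ s : ↥S, s ∈ Φ.source := fun s => show s ∈ e.target from het ▸ mem_univ s
  have hcirc : IsLocalDiffeomorph 𝓘(ℝ, ℝ) (𝓡 1) ∞ (fun s : ↥S => circlePt (s : ℝ)) :=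
    fun s => ⟨Φ, hΦs s, fun s _ => (hes s).symm⟩
  have hcinj : Injective fun s : ↥S => circlePt (s : ℝ) := fun s s' h =>
    e.symm.injOn (hΦs s) (hΦs s') (show e.symm s = e.symm s' by rw [hes, hes]; exact h)
  have idS := (Diffeomorph.refl 𝓘(ℝ, ℝ) ↥S ∞).isLocalDiffeomorph
  have idE := (Diffeomorph.refl 𝓘(ℝ, 𝔼 2) (𝔼 2) ∞).isLocalDiffeomorph
  -- across the puncture: at `(d w, s)`, `‖w‖ < 1`, read through `d × id`
  have hdisc : ∀ w : 𝔼 2, ‖w‖ < 1 → ∀ s : ↥S,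
      IsLocalDiffeomorphAt ((𝓡 2).prod 𝓘(ℝ, ℝ)) (𝓡 3) ∞ (capMap jS jc jt) (d w, s) := by
    intro w hw s
    have hι := (isLocalDiffeomorphAt_of_isSmoothEmbedding hd hdo w).prodMap' (idS s)
    have hσ := (idE w).prodMap' (hcirc s)
    have hmem : ((w, circlePt (s : ℝ)) : (𝔼 2) × (𝕊 1)) ∈ solidTorus := (mem_solidTorus_iff _).2 hw
    -- the extended meridian-disc map is a local diffeomorphism on the open solid torus
    have hj := isLocalDiffeomorphAt_of_comp_eventuallyEq (f := solidTorusExt jt)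
      (isLocalDiffeomorphAt_subtypeVal solidTorus ⟨_, hmem⟩)
      (isLocalDiffeomorphAt_of_isSmoothEmbedding ht hto _)
      (Filter.Eventually.of_forall fun b : ↥solidTorus => (dif_pos b.2 : solidTorusExt jt b = _))
    have hev : ∀ᶠ x in 𝓝 ((w, s) : (𝔼 2) × ↥S),
        capMap jS jc jt (Prod.map d (Diffeomorph.refl 𝓘(ℝ, ℝ) ↥S ∞) x) = (solidTorusExt jt ∘
          Prod.map (Diffeomorph.refl 𝓘(ℝ, 𝔼 2) (𝔼 2) ∞) (fun s : ↥S => circlePt (s : ℝ))) x := by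
      filter_upwards [(Metric.isOpen_ball.preimage continuous_fst).mem_nhds
        (show ((w, s) : (𝔼 2) × ↥S).1 ∈ Metric.ball (0 : 𝔼 2) 1 from mem_ball_zero_iff.2 hw)]
        with x hx
      have hx' : ‖x.1‖ < 1 := mem_ball_zero_iff.1 hx
      show capMap jS jc jt (d x.1, x.2) = solidTorusExt jt (x.1, circlePt (x.2 : ℝ))
      have hq : (x.1, circlePt (x.2 : ℝ)) ∈ solidTorus := (mem_solidTorus_iff (_ : _ × _)).2 hx'
      rw [capMap_apply_disc ν jS jc jt d hglue hd.isEmbedding.injective hd0 hbook hx']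
      exact (dif_pos hq : solidTorusExt jt _ = _).symm
    have key := isLocalDiffeomorphAt_of_comp_eventuallyEq hι (hσ.comp (K := 𝓡 3) (P := Y) hj) hev
    exact key
  have hloc : IsLocalDiffeomorph ((𝓡 2).prod 𝓘(ℝ, ℝ)) (𝓡 3) ∞ (capMap jS jc jt) := by
    rintro ⟨y, s⟩
    by_cases hy : y = p
    · subst hy; simpa only [hd0] using hdisc 0 (by rw [norm_zero]; exact one_pos) s
    · -- off the puncture: read through `(F ∖ {p}) × S ↪ F × S` it is `jc ∘ jS`
      have hι := (isLocalDiffeomorphAt_subtypeVal (I₁ := 𝓡 2) (punctureAt p) ⟨y, hy⟩).prodMap'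
        (idS s)
      have hg : IsLocalDiffeomorphAt ((𝓡 2).prod 𝓘(ℝ, ℝ)) (𝓡 3) ∞ (jc ∘ jS) (⟨y, hy⟩, s) :=
        (isLocalDiffeomorphAt_of_isSmoothEmbedding hS hSo _).comp (K := 𝓡 3) (P := Y)
          (isLocalDiffeomorphAt_of_isSmoothEmbedding hc hco _)
      have key := isLocalDiffeomorphAt_of_comp_eventuallyEq hι hg
        (Filter.Eventually.of_forall fun x => capMap_apply_of_ne jS jc jt x.1.2 x.2)
      exact key
  have hinj : Injective (capMap jS jc jt) := by
    rintro ⟨y, s⟩ ⟨y', s'⟩ h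
    by_cases hy : y = p <;> by_cases hy' : y' = p
    · rw [hy, capMap_apply_puncture] at h
      rw [hy', capMap_apply_puncture] at h
      have h1 := congrArg (fun b : ↥solidTorus => b.1.2) (ht.isEmbedding.injective h)
      rw [hy, hy', show s = s' from hcinj h1]
    · rw [hy, capMap_apply_puncture, capMap_apply_of_ne jS jc jt hy'] at h
      exact absurd h.symm (apply_ne_apply_centre ν jc jt hglue _ _)
    · rw [hy', capMap_apply_puncture, capMap_apply_of_ne jS jc jt hy] at h
      exact absurd h (apply_ne_apply_centre ν jc jt hglue _ _)
    · rw [capMap_apply_of_ne jS jc jt hy, capMap_apply_of_ne jS jc jt hy'] at h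
      obtain ⟨h1, h2⟩ := Prod.mk.inj (hS.isEmbedding.injective (hc.isEmbedding.injective h))
      rw [Subtype.mk.injEq] at h1
      rw [h1, h2]
  have L : ((𝔼 2) × ℝ) ≃L[ℝ] (𝔼 3) :=
    ContinuousLinearEquiv.ofFinrankEq (by simp [Module.finrank_prod])
  exact ⟨isSmoothEmbedding_of_isLocalDiffeomorph hloc hinj L, hloc.isOpen_range⟩

/-- **When do the disc centres over `s ∈ (0, 1)` and `t ∈ (1/2, 3/2)` coincide?** Exactly when
`t = s` or `t = s + 1` (read off the angle functions `angA`, `angB`): the mapping-torus relation at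
the puncture. [folklore] -/
theorem circlePt_eq_circlePt_iff_pieces (s : ↥mappingTorusPieceOne) (t : ↥mappingTorusPieceTwo) :
    circlePt (s : ℝ) = circlePt (t : ℝ) ↔ (t : ℝ) = s ∨ (t : ℝ) = s + 1 := by
  refine ⟨fun h => ?_, ?_⟩
  · have hA := angA_circlePt (coe_prop_pieceOne s)
    have hB := angB_circlePt (coe_prop_pieceTwo t)
    have hne : circlePt (t : ℝ) ≠ ptA := h ▸ circlePt_ne_ptA s
    rw [h] at hA
    rcases angB_eq_of_ne hne (circlePt_ne_ptB t) with ⟨-, h2⟩ | ⟨-, h2⟩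
    · right; rw [← hB, h2, hA]
    · left; rw [← hB, h2, hA]
  · rintro (h | h)
    · rw [h]
    · rw [h, circlePt_add_one]

/-- **The two capped cylinders cover `Y`**: the image of the knot complement is covered by the
pages; `jt (w, v)`, `w ≠ 0`, is glued to the complement point `ν (w/‖w‖, ‖w‖ • v)`; a core point
`jt (0, v)` is the image of the puncture on the page through `v` (angle `angA v` or `angB v`)
(Rolfsen (1976), §9.F; Abe–Tagami, arXiv:1502.01102, §5.5). [cite: AbeTagami2016, §5.5] -/
theorem union_range_capMap_eq_univ (hU : range jc ∪ range jt = univ)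
    (hR : ∀ a b, jc a = jt b ↔ surgeryRel ν a b) (hUc : range jA ∪ range jB = univ) :
    range (capMap jA jc jt) ∪ range (capMap jB jc jt) = univ := by
  refine eq_univ_of_forall fun z => ?_
  have hcpl : ∀ c : ↥K.complement, jc c ∈ range (capMap jA jc jt) ∪ range (capMap jB jc jt) := by
    intro c
    have hc' : c ∈ range jA ∪ range jB := by rw [hUc]; exact mem_univ c
    rcases hc' with ⟨⟨y, s⟩, rfl⟩ | ⟨⟨y, t⟩, rfl⟩
    · exact Or.inl ⟨((y : F), s), capMap_apply_of_ne jA jc jt y.2 s⟩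
    · exact Or.inr ⟨((y : F), t), capMap_apply_of_ne jB jc jt y.2 t⟩
  have hz : z ∈ range jc ∪ range jt := by rw [hU]; exact mem_univ z
  rcases hz with ⟨c, rfl⟩ | ⟨⟨⟨w, v⟩, hb⟩, rfl⟩
  · exact hcpl c
  by_cases hw0 : w = 0
  · -- the core circle: `(0, v)` is the centre of the disc capping the page through `v`
    subst hw0
    by_cases hv : v = ptA
    · refine Or.inr ⟨(p, angleChartB v), (capMap_apply_puncture jB jc jt _).trans ?_⟩
      congr 1
      exact Subtype.ext (Prod.ext rfl (angleChartB.left_inv (show v ≠ ptB from hv ▸ ptA_ne_ptB)))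
    · refine Or.inl ⟨(p, angleChartA v), (capMap_apply_puncture jA jc jt _).trans ?_⟩
      congr 1
      exact Subtype.ext (Prod.ext rfl (angleChartA.left_inv hv))
  · -- the punctured solid torus is glued to the complement
    have hw1 : ‖w‖ < 1 := (mem_solidTorus_iff ((w, v) : (𝔼 2) × (𝕊 1))).1 hb
    have hnorm : 0 < ‖w‖ := norm_pos_iff.2 hw0
    have hu : ‖w‖⁻¹ • w ∈ Metric.sphere (0 : 𝔼 2) 1 := by
      rw [mem_sphere_zero_iff_norm, norm_smul, norm_inv, norm_norm, inv_mul_cancel₀ hnorm.ne']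
    have hmem : ν (⟨_, hu⟩, ‖w‖ • (v : 𝔼 2)) ∈ K.complement :=
      ν.apply_mem_compl_range (smul_ne_zero hnorm.ne' (ne_zero_of_mem_unit_sphere v))
    have hrel : surgeryRel ν ⟨ν (⟨_, hu⟩, ‖w‖ • (v : 𝔼 2)), hmem⟩ ⟨(w, v), hb⟩ :=
      ⟨⟨_, hu⟩, ‖w‖, ⟨hnorm, hw1⟩, (smul_inv_smul₀ hnorm.ne' w).symm, rfl⟩
    rw [← (hR _ _).2 hrel]
    exact hcpl _

/-- **The two capped cylinders meet along `mappingTorusRel φ`**: off the puncture this is the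
pages' relation `mappingTorusRel θ` (`θ = φ|`); a page point is never glued to a disc centre
(`φ p = p ≠ y`); the disc centres over `s`, `t` agree iff `t - s ∈ {0, 1}`, i.e. `mappingTorusRel φ`
at the fixed point `p` (Abe–Tagami, arXiv:1502.01102, §5.5). [cite: AbeTagami2016, §5.5] -/
theorem capMap_eq_capMap_iff [ChartedSpace (𝔼 2) F] (φ : F ≃ₘ⟮𝓡 2, 𝓡 2⟯ F)
    (θ : ↥(punctureAt p) ≃ₘ⟮𝓡 2, 𝓡 2⟯ ↥(punctureAt p))
    (hθ : ∀ y : ↥(punctureAt p), ((θ y : ↥(punctureAt p)) : F) = φ (y : F)) (hφp : φ p = p)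
    (hR : ∀ a b, jc a = jt b ↔ surgeryRel ν a b)
    (hRel : ∀ a b, jA a = jB b ↔ mappingTorusRel ⇑θ a b) (hinjc : Injective jc)
    (hinjt : Injective jt) (a : F × ↥mappingTorusPieceOne) (b : F × ↥mappingTorusPieceTwo) :
    capMap jA jc jt a = capMap jB jc jt b ↔ mappingTorusRel ⇑φ a b := by
  obtain ⟨y, s⟩ := a
  obtain ⟨y', t⟩ := b
  by_cases hy : y = p <;> by_cases hy' : y' = p
  · rw [hy, hy', capMap_apply_puncture, capMap_apply_puncture, hinjt.eq_iff]
    simp only [Subtype.mk.injEq, Prod.mk.injEq, true_and, circlePt_eq_circlePt_iff_pieces,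
      mappingTorusRel, hφp, and_true]
  · rw [hy, capMap_apply_puncture, capMap_apply_of_ne jB jc jt hy']
    refine iff_of_false (fun h => apply_ne_apply_centre ν jc jt hR _ _ h.symm) ?_
    rintro (⟨-, h⟩ | ⟨-, h⟩)
    · exact hy' h
    · exact hy' (h.trans hφp)
  · rw [hy', capMap_apply_puncture, capMap_apply_of_ne jA jc jt hy]
    refine iff_of_false (fun h => apply_ne_apply_centre ν jc jt hR _ _ h) ?_
    rintro (⟨-, h⟩ | ⟨-, h⟩)
    · exact hy (Eq.symm h)
    · exact hy (φ.injective ((Eq.symm h).trans hφp.symm))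
  · rw [capMap_apply_of_ne jA jc jt hy, capMap_apply_of_ne jB jc jt hy', hinjc.eq_iff, hRel]
    have e1 : ((⟨y', hy'⟩ : ↥(punctureAt p)) = ⟨y, hy⟩) ↔ y' = y := Subtype.mk_eq_mk
    have e2 : ((⟨y', hy'⟩ : ↥(punctureAt p)) = θ ⟨y, hy⟩) ↔ y' = φ y := by
      rw [Subtype.ext_iff, hθ]
    unfold mappingTorusRel
    rw [e1, e2]

/-- **Stub 2 (`S³₀(K) = T_φ` for a fibred knot; KNOWN).** If `K` fibres through `ν` with capped
fibre `F` and capped monodromy `φ`, `ν` has framing `0`, and `Y` is ANY `0`-surgery on `K`, then `Y`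
is a smooth mapping torus of `φ`: (1) `Y` is glued along `surgeryRel ν` for THE fibration's `ν`
(`IsOpenGluing.surgeryRel_of_hasFraming`: same framing integer, no surgery uniqueness needed);
(2) cap both page cylinders inside `Y` with the meridian discs of the surgery solid torus
(`isSmoothEmbedding_capMap` over `(0, 1)`, `(1/2, 3/2)`, angle charts `angleChartA/B`); (3) they
cover `Y` and meet along `mappingTorusRel φ` (`union_range_capMap_eq_univ`, `capMap_eq_capMap_iff`;
`θ = φ|`, `φ p = p`). "`0`-surgery on a fibred knot is the closed monodromy's mapping torus"
(Abe–Tagami, arXiv:1502.01102, §5.5; Rolfsen (1976), §10.K). [cite: AbeTagami2016, §5.5] -/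
theorem stub_zeroSurgery_of_fibresWithVia :
    ∀ (K : Knot) (ν : Knot.TubularNbhd K) (F : Type) [TopologicalSpace F] [T2Space F]
      [SecondCountableTopology F] [ChartedSpace (𝔼 2) F] [IsManifold (𝓡 2) ∞ F] [CompactSpace F]
      [ConnectedSpace F] (p : F) (φ : F ≃ₘ⟮𝓡 2, 𝓡 2⟯ F)
      (Y : Type) [TopologicalSpace Y] [T2Space Y] [SecondCountableTopology Y]
      [ChartedSpace (𝔼 3) Y] [IsManifold (𝓡 3) ∞ Y],
      FibresWithVia K ν F p φ → ν.HasFraming 0 → IsIntegralSurgery (𝓡 3) Y K 0 →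
        IsMappingTorusOf (𝓡 3) Y φ := by
  intro K ν F _ _ _ _ _ _ _ p φ Y _ _ _ _ _ hfib hν hY
  have hφp : φ p = p := hfib.apply_puncture
  obtain ⟨ν', hν', hG⟩ := hY
  obtain ⟨jc, jt, hc, hco, ht, hto, hU, hR⟩ := hG.surgeryRel_of_hasFraming hν' hν
  obtain ⟨θ, jA, jB, d, hθ, ⟨hA, hAo, hB, hBo, hUc, hRel⟩, hd, hdo, hd0, hbook⟩ := hfib
  obtain ⟨hJA, hJAo⟩ := isSmoothEmbedding_capMap ν jA jc jt d hA hAo hc hco ht hto hd hdo hR hd0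
    (fun y u r hr hy s => (hbook y u r hr hy).1 s) angleChartA rfl contMDiffOn_angleChartA
    contMDiff_angleChartA_symm fun _ => rfl
  obtain ⟨hJB, hJBo⟩ := isSmoothEmbedding_capMap ν jB jc jt d hB hBo hc hco ht hto hd hdo hR hd0
    (fun y u r hr hy t => (hbook y u r hr hy).2 t) angleChartB rfl contMDiffOn_angleChartB
    contMDiff_angleChartB_symm fun _ => rfl
  exact ⟨capMap jA jc jt, capMap jB jc jt, hJA, hJAo, hJB, hJBo,
    union_range_capMap_eq_univ ν jA jB jc jt hU hR hUc,
    capMap_eq_capMap_iff ν jA jB jc jt φ θ hθ hφp hR hRel hc.isEmbedding.injective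
      ht.isEmbedding.injective⟩

end Summit.SmoothPoincare4.SmoothPoincare4.Theorems.ZseCruxRasmussen.MonodromyKernelEngine

end
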